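import Summits.AtomisticToContinuum.BoseEinsteinCondensation.Theses.BECStronglyRayleigh
import Summits.AtomisticToContinuum.BoseEinsteinCondensation.Theorems.InsertionFieldDelocalisation.Negative.Toolkit
import Summits.AtomisticToContinuum.BoseEinsteinCondensation.Theorems.InsertionFieldDelocalisation.Negative.PerronExistence
import Summits.AtomisticToContinuum.BoseEinsteinCondensation.Theorems.InsertionFieldDelocalisation.Negative.Tightness
import Summits.AtomisticToContinuum.BoseEinsteinCondensation.Theorems.BECStronglyRayleighInsertionFieldDelocalisationEmbedding
import Literature.MathematicalPhysics.QuantumLattice.LiebMattisLadder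
import Literature.MathematicalPhysics.QuantumLattice.LiebMattisSectorPF
import Literature.MathematicalPhysics.QuantumLattice.SectorSpectrum
import Literature.Probability.LatticeModels.IsingTransport
import HarnessLib

/-!
# Two-body base of line `cosh-budget-penrose-onsager` (crux `InsertionFieldDelocalisation`,
# stmt-AtomisticToContinuum-9673), II: the two-particle sector energy of hard-core bosons on
# `(ℤ/Lℤ)³` is within `6/(L³ - 1)` of `-deg(0)`

Helper file for the registered stub `stub_twoBodyBase`.  For `H = xyTorus 3 L 1` (hard-core bosons
= ferro spin-½ XY model, hopping `-½` per allowed nearest-neighbour move, occupied = index `0`) and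
the two-particle sector energy `E = E(2) = lowestEnergyInSector 1 H (2 - L³/2)`:

  `(deg(0) + E) · (L³ - 1) ≤ 6`  (`cb1tb_energy_bound`),

by the variational principle with the FLAT test vector on the `2`-set indicators: its Rayleigh
quotient is `-½ Σ_{|S|=2} ∂S / C(L³,2)`, the hop count of `S = {x,y}` is
`∂S = 2 deg(0) - 2[x ∼ y]` (the torus graph is regular, `cb1tb_degree_eq`), and the number of
nearest-neighbour pairs is at most `3L³` (they are of the form `{a, a + eᵢ}`, `cb1tb_pair_mem_image`).
Also: sums over weight sectors as sums over occupied sets (`cb1tb_sum_weight_eq_sum_powersetCard`).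
-/

noncomputable section

namespace Summit.AtomisticToContinuum.BoseEinsteinCondensation.Cruxes.InsertionFieldDelocalisation.CoshBudgetPenroseOnsager

open scoped BigOperators ComplexOrder
open Literature.MathematicalPhysics.QuantumLattice Literature.Probability.LatticeModels Matrix Finset
open Summit.AtomisticToContinuum.BoseEinsteinCondensation.Theorems.InsertionFieldDelocalisation.Negative
open Summit.AtomisticToContinuum.BoseEinsteinCondensation.Cruxes.InsertionFieldDelocalisation.MobileTrapDirichletEigenfunction
  (mt3em_xxzZero_mulVec_ind)

/-! ### Sums over a weight sector as sums over occupied sets -/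

section Config

variable {Λ : Type*} [Fintype Λ] [DecidableEq Λ]

/-- **Configurations of weight `|Λ| - n` are the indicators of the `n`-sets**:
`Σ_{σ : Σσ = |Λ| - n} F(σ) = Σ_{|S| = n} F(1_S)` (occupied = index `0`). [folklore] -/
theorem cb1tb_sum_weight_eq_sum_powersetCard {M : Type*} [AddCommMonoid M]
    (F : TensorIndex Λ 2 → M) (n : ℕ) (hn : n ≤ Fintype.card Λ) :
    ∑ σ, (if (∑ z, (σ z : ℕ)) = Fintype.card Λ - n then F σ else 0) =
      ∑ S ∈ (univ : Finset Λ).powersetCard n, F (fun z => if z ∈ S then 0 else 1) := by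
  rw [← Finset.sum_filter]
  refine Finset.sum_nbij' (fun σ => univ.filter (fun z => σ z = 0))
    (fun S => fun z => if z ∈ S then 0 else 1) ?_ ?_ ?_ ?_ ?_
  · intro σ hσ
    simp only [Finset.mem_filter, Finset.mem_univ, true_and] at hσ
    rw [Finset.mem_powersetCard]
    refine ⟨Finset.subset_univ _, ?_⟩
    have h : (∑ z, (σ z : ℕ)) = (univ.filter (fun z => σ z = 0))ᶜ.card := by
      calc (∑ z, (σ z : ℕ))
          = ∑ z, (((fun z => if z ∈ univ.filter (fun z => σ z = 0) then (0 : Fin 2) else 1) z : Fin 2) : ℕ) := by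
            rw [ind_filter_eq σ]
        _ = (univ.filter (fun z => σ z = 0))ᶜ.card := weight_ind _
    rw [Finset.card_compl, hσ] at h
    have hle : (univ.filter (fun z => σ z = 0)).card ≤ Fintype.card Λ := Finset.card_le_univ _
    omega
  · intro S hS
    rw [Finset.mem_powersetCard] at hS
    simp only [Finset.mem_filter, Finset.mem_univ, true_and]
    rw [weight_ind S, Finset.card_compl, hS.2]
  · intro σ _
    exact ind_filter_eq σ
  · intro S _
    ext z
    simp only [Finset.mem_filter, Finset.mem_univ, true_and]
    by_cases hz : z ∈ S <;> simp [hz]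
  · intro σ _
    rw [ind_filter_eq σ]

end Config

/-! ### The torus graph: regularity and nearest-neighbour pairs -/

section Torus

variable (L : ℕ)

/-- **The torus graph is regular**: `#{b : a ∼ b} = #{b : 0 ∼ b}` (translate by `-a`). [folklore] -/
theorem cb1tb_degree_eq (a : TorusSite 3 L) [NeZero L] :
    (∑ b, (if (torusGraph 3 L).Adj a b then (1 : ℝ) else 0)) =
      ∑ b, (if (torusGraph 3 L).Adj 0 b then (1 : ℝ) else 0) := by
  refine Fintype.sum_equiv (Equiv.subRight a) _ _ fun b => ?_
  rw [Equiv.subRight_apply]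
  have hiff : (torusGraph 3 L).Adj a b ↔ (torusGraph 3 L).Adj 0 (b - a) := by
    have h := torusGraph_adj_add_right (-a) a b
    rw [add_neg_cancel, ← sub_eq_add_neg] at h
    exact h.symm
  by_cases h : (torusGraph 3 L).Adj a b
  · rw [if_pos h, if_pos (hiff.1 h)]
  · rw [if_neg h, if_neg (fun h' => h (hiff.2 h'))]

/-- **Nearest-neighbour pairs are `{a, a + eᵢ}`**: for `x ∼ y` on the torus, `{x, y}` lies in the
image of `(a, i) ↦ {a, a + eᵢ}`. [folklore] -/
theorem cb1tb_pair_mem_image {x y : TorusSite 3 L} (h : (torusGraph 3 L).Adj x y) [NeZero L] :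
    ({x, y} : Finset (TorusSite 3 L)) ∈ (univ : Finset (TorusSite 3 L × Fin 3)).image
      (fun p => ({p.1, p.1 + Pi.single p.2 1} : Finset (TorusSite 3 L))) := by
  rw [torusGraph_adj_iff] at h
  rw [Finset.mem_image]
  rcases h.2 with ⟨i, hi⟩ | ⟨i, hi⟩
  · exact ⟨(x, i), Finset.mem_univ _, by rw [hi]⟩
  · exact ⟨(y, i), Finset.mem_univ _, by rw [← hi, Finset.pair_comm]⟩

/-- **Hop count of a pair**: for a `2`-set `S = {x, y}`,
`2 deg(0) ≤ #{(a,b) : a ∈ S, b ∉ S, a ∼ b} + 2 [S is a nearest-neighbour pair]`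
(each of `x`, `y` loses at most the hop onto its partner). [folklore] -/
theorem cb1tb_boundary_pair [NeZero L] (S : Finset (TorusSite 3 L)) (hS : S.card = 2) :
    2 * (∑ b, (if (torusGraph 3 L).Adj 0 b then (1 : ℝ) else 0)) ≤
      (∑ a ∈ S, ∑ b, (if b ∉ S ∧ (torusGraph 3 L).Adj a b then (1 : ℝ) else 0)) +
        2 * (if S ∈ (univ : Finset (TorusSite 3 L × Fin 3)).image
              (fun p => ({p.1, p.1 + Pi.single p.2 1} : Finset (TorusSite 3 L)))
            then (1 : ℝ) else 0) := by
  obtain ⟨x, y, hxy, rfl⟩ := Finset.card_eq_two.1 hS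
  set ind : ℝ := (if ({x, y} : Finset (TorusSite 3 L)) ∈
      (univ : Finset (TorusSite 3 L × Fin 3)).image
        (fun p => ({p.1, p.1 + Pi.single p.2 1} : Finset (TorusSite 3 L))) then (1 : ℝ) else 0)
    with hind
  have hind0 : 0 ≤ ind := by rw [hind]; split_ifs <;> norm_num
  have hind1 : (torusGraph 3 L).Adj x y → ind = 1 := fun h => by
    rw [hind, if_pos (cb1tb_pair_mem_image L h)]
  -- per element of the pair
  have key : ∀ a ∈ ({x, y} : Finset (TorusSite 3 L)),
      (∑ b, (if (torusGraph 3 L).Adj 0 b then (1 : ℝ) else 0)) ≤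
        (∑ b, (if b ∉ ({x, y} : Finset (TorusSite 3 L)) ∧ (torusGraph 3 L).Adj a b
          then (1 : ℝ) else 0)) + ind := by
    intro a ha
    rw [← cb1tb_degree_eq L a]
    have hsplit : ∀ b, (if (torusGraph 3 L).Adj a b then (1 : ℝ) else 0) =
        (if b ∉ ({x, y} : Finset (TorusSite 3 L)) ∧ (torusGraph 3 L).Adj a b then (1 : ℝ) else 0) +
          (if b ∈ ({x, y} : Finset (TorusSite 3 L)) then
            (if (torusGraph 3 L).Adj a b then (1 : ℝ) else 0) else 0) := by
      intro b
      by_cases hb : b ∈ ({x, y} : Finset (TorusSite 3 L)) <;>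
        by_cases hab : (torusGraph 3 L).Adj a b <;> simp [hb, hab]
    rw [Finset.sum_congr rfl fun b _ => hsplit b, Finset.sum_add_distrib, Finset.sum_ite_mem_eq,
      Finset.sum_pair hxy]
    gcongr
    rw [Finset.mem_insert, Finset.mem_singleton] at ha
    rcases ha with rfl | rfl
    · rw [if_neg (SimpleGraph.irrefl _), zero_add]
      by_cases h : (torusGraph 3 L).Adj a y
      · rw [if_pos h, hind1 h]
      · rw [if_neg h]
        exact hind0
    · rw [if_neg (SimpleGraph.irrefl _), add_zero]
      by_cases h : (torusGraph 3 L).Adj a x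
      · rw [if_pos h, hind1 h.symm]
      · rw [if_neg h]
        exact hind0
  have hsum := Finset.sum_le_sum key
  rw [Finset.sum_const, Finset.card_pair hxy, nsmul_eq_mul, Finset.sum_add_distrib, Finset.sum_const,
    Finset.card_pair hxy, nsmul_eq_mul] at hsum
  push_cast at hsum
  linarith

end Torus

/-! ### The variational bound on the two-particle sector energy -/

/-- **Two hard-core bosons on the three-torus almost do not repel**: for `L ≥ 2` the two-particle
sector energy `E(2)` of `xyTorus 3 L 1` satisfies `(deg(0) + E(2)) (L³ - 1) ≤ 6`, by the variational
principle (`sector_groundState`) with the flat vector on the `2`-set indicators, whose Rayleigh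
quotient is `-½ Σ_{|S|=2} ∂S / C(L³,2) ≤ -deg(0) + 6/(L³-1)` (`cb1tb_boundary_pair`, at most `3L³`
nearest-neighbour pairs). [folklore] -/
theorem cb1tb_energy_bound (L : ℕ) [NeZero L] (hL : 2 ≤ L) :
    ((∑ b : TorusSite 3 L, (if (torusGraph 3 L).Adj 0 b then (1 : ℝ) else 0)) +
        lowestEnergyInSector 1 (xyTorus 3 L 1) (((2 : ℕ) : ℝ) - (L : ℝ) ^ 3 / 2)) *
      ((L : ℝ) ^ 3 - 1) ≤ 6 := by
  set D₀ := ∑ b : TorusSite 3 L, (if (torusGraph 3 L).Adj 0 b then (1 : ℝ) else 0) with hD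
  set E := lowestEnergyInSector 1 (xyTorus 3 L 1) (((2 : ℕ) : ℝ) - (L : ℝ) ^ 3 / 2) with hE
  set P2 := (univ : Finset (TorusSite 3 L)).powersetCard 2 with hP2def
  have hV : Fintype.card (TorusSite 3 L) = L ^ 3 :=
    Summit.AtomisticToContinuum.BoseEinsteinCondensation.Theorems.InsertionFieldDelocalisation.Negative.card_torusSite 3 L
  have hL3 : 8 ≤ L ^ 3 :=
    calc 8 = 2 ^ 3 := by norm_num
      _ ≤ L ^ 3 := Nat.pow_le_pow_left hL 3
  have hV0 : (0 : ℝ) < (L : ℝ) ^ 3 := by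
    have : (0 : ℝ) < L := by exact_mod_cast (by omega : 0 < L)
    positivity
  -- the flat test vector on the `2`-set indicators and its sector
  set φ : TensorIndex (TorusSite 3 L) 2 → ℂ :=
    fun σ => if (∑ z, (σ z : ℕ)) = L ^ 3 - 2 then 1 else 0 with hφ
  have hφσ : ∀ σ, φ σ = if (∑ z, (σ z : ℕ)) = L ^ 3 - 2 then 1 else 0 := fun σ => rfl
  have hM : ((Fintype.card (TorusSite 3 L) * 1 : ℕ) : ℝ) / 2 - ((L ^ 3 - 2 : ℕ) : ℝ) =
      ((2 : ℕ) : ℝ) - (L : ℝ) ^ 3 / 2 := by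
    rw [hV, Nat.cast_sub (by omega : 2 ≤ L ^ 3)]
    push_cast
    ring
  have hK : ∀ v, v ∈ spinZSector (Λ := TorusSite 3 L) 1 (((2 : ℕ) : ℝ) - (L : ℝ) ^ 3 / 2) ↔
      ∀ σ, ¬(∑ z, (σ z : ℕ)) = L ^ 3 - 2 → v σ = 0 := by
    intro v
    rw [← hM]
    exact LiebMattis.mem_spinZSector_weight_iff 1 (L ^ 3 - 2) v
  have hφK : φ ∈ spinZSector (Λ := TorusSite 3 L) 1 (((2 : ℕ) : ℝ) - (L : ℝ) ^ 3 / 2) :=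
    (hK φ).2 fun σ hσ => if_neg hσ
  -- the variational principle in the sector
  obtain ⟨S₀, -, hS₀⟩ : ∃ S ⊆ (univ : Finset (TorusSite 3 L)), S.card = 2 :=
    Finset.exists_subset_card_eq (by rw [Finset.card_univ, hV]; omega)
  have hp : ∃ σ : TensorIndex (TorusSite 3 L) 2, (∑ z, (σ z : ℕ)) = L ^ 3 - 2 :=
    ⟨fun z => if z ∈ S₀ then 0 else 1, by rw [weight_ind S₀, Finset.card_compl, hS₀, hV]⟩
  have hinv : ∀ σ τ : TensorIndex (TorusSite 3 L) 2, ¬(∑ z, (σ z : ℕ)) = L ^ 3 - 2 →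
      (∑ z, (τ z : ℕ)) = L ^ 3 - 2 → xyTorus 3 L 1 σ τ = 0 := fun σ τ hσ hτ =>
    xxzZero_apply_eq_zero_of_weight_ne (torusGraph 3 L) (-1) (by rw [hτ]; exact hσ)
  obtain ⟨-, hlow⟩ := sector_groundState (xyTorus 3 L 1) (xxzZero_isHermitian (torusGraph 3 L) (-1))
    (fun σ => (∑ z, (σ z : ℕ)) = L ^ 3 - 2) hp hinv _ hK
  have hvar : E * (star φ ⬝ᵥ φ).re ≤ (star φ ⬝ᵥ xyTorus 3 L 1 *ᵥ φ).re :=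
    LiebMattis.mul_norm_le_of_unit_bound 1 (xyTorus 3 L 1) _ hlow hφK
  -- `‖φ‖² = C(L³, 2)`
  have hnorm : (star φ ⬝ᵥ φ).re = (P2.card : ℝ) := by
    have h1 : star φ ⬝ᵥ φ = ∑ σ : TensorIndex (TorusSite 3 L) 2,
        (if (∑ z, (σ z : ℕ)) = Fintype.card (TorusSite 3 L) - 2 then (1 : ℂ) else 0) := by
      rw [dotProduct]
      refine Finset.sum_congr rfl fun σ _ => ?_
      rw [Pi.star_apply, hφσ σ, hV]
      split_ifs <;> simp
    rw [h1, cb1tb_sum_weight_eq_sum_powersetCard (fun _ => (1 : ℂ)) 2 (by rw [hV]; omega)]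
    simp [hP2def]
  -- `⟨φ, Hφ⟩ = -½ Σ_{|S|=2} ∂S`
  have hHφ : ∀ S ∈ P2, (xyTorus 3 L 1 *ᵥ φ) (fun z => if z ∈ S then 0 else 1) =
      (((-1 : ℝ) / 2 : ℝ) : ℂ) *
        ((∑ a ∈ S, ∑ b, (if b ∉ S ∧ (torusGraph 3 L).Adj a b then (1 : ℝ) else 0) : ℝ) : ℂ) := by
    intro S hS
    have hS2 : S.card = 2 := (Finset.mem_powersetCard.1 hS).2
    rw [xyTorus, mt3em_xxzZero_mulVec_ind]
    congr 1
    push_cast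
    refine Finset.sum_congr rfl fun a ha => Finset.sum_congr rfl fun b _ => ?_
    split_ifs with hb
    · have hw : (∑ z, ((if z ∈ insert b (S.erase a) then (0 : Fin 2) else 1 : Fin 2) : ℕ)) =
          L ^ 3 - 2 := by
        rw [weight_ind, Finset.card_compl, hV,
          Finset.card_insert_of_notMem (fun h => hb.1 (Finset.mem_of_mem_erase h)),
          Finset.card_erase_of_mem ha, hS2]
      rw [hφσ, if_pos hw, Complex.ofReal_one]
    · rfl
  have henergy : (star φ ⬝ᵥ xyTorus 3 L 1 *ᵥ φ).re =
      -(1 / 2) * ∑ S ∈ P2, ∑ a ∈ S, ∑ b, (if b ∉ S ∧ (torusGraph 3 L).Adj a b then (1 : ℝ) else 0) := by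
    have h1 : star φ ⬝ᵥ xyTorus 3 L 1 *ᵥ φ = ∑ σ : TensorIndex (TorusSite 3 L) 2,
        (if (∑ z, (σ z : ℕ)) = Fintype.card (TorusSite 3 L) - 2 then (xyTorus 3 L 1 *ᵥ φ) σ else 0) := by
      rw [dotProduct]
      refine Finset.sum_congr rfl fun σ _ => ?_
      rw [Pi.star_apply, hφσ σ, hV]
      split_ifs <;> simp
    rw [h1, cb1tb_sum_weight_eq_sum_powersetCard (fun σ => (xyTorus 3 L 1 *ᵥ φ) σ) 2 (by rw [hV]; omega),
      Complex.re_sum, Finset.mul_sum]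
    refine Finset.sum_congr rfl fun S hS => ?_
    rw [hHφ S hS, ← Complex.ofReal_mul, Complex.ofReal_re]
    ring
  -- the hop count: `Σ_{|S|=2} ∂S ≥ 2 deg(0) C(L³,2) - 6 L³`
  have hcount : 2 * D₀ * (P2.card : ℝ) ≤
      (∑ S ∈ P2, ∑ a ∈ S, ∑ b, (if b ∉ S ∧ (torusGraph 3 L).Adj a b then (1 : ℝ) else 0)) +
        2 * (3 * (L : ℝ) ^ 3) := by
    set edgy := (univ : Finset (TorusSite 3 L × Fin 3)).image
      (fun p => ({p.1, p.1 + Pi.single p.2 1} : Finset (TorusSite 3 L))) with hedgy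
    have h1 : ∑ S ∈ P2, 2 * D₀ ≤ ∑ S ∈ P2,
        ((∑ a ∈ S, ∑ b, (if b ∉ S ∧ (torusGraph 3 L).Adj a b then (1 : ℝ) else 0)) +
          2 * (if S ∈ edgy then (1 : ℝ) else 0)) :=
      Finset.sum_le_sum fun S hS => cb1tb_boundary_pair L S (Finset.mem_powersetCard.1 hS).2
    rw [Finset.sum_const, nsmul_eq_mul, Finset.sum_add_distrib, ← Finset.mul_sum] at h1
    have h2 : ∑ S ∈ P2, (if S ∈ edgy then (1 : ℝ) else 0) ≤ 3 * (L : ℝ) ^ 3 := by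
      rw [← Finset.sum_filter, Finset.sum_const, nsmul_eq_mul, mul_one]
      have h3 : (P2.filter (· ∈ edgy)).card ≤ edgy.card :=
        Finset.card_le_card fun S hS => (Finset.mem_filter.1 hS).2
      have h4 : edgy.card ≤ 3 * L ^ 3 :=
        calc edgy.card ≤ (univ : Finset (TorusSite 3 L × Fin 3)).card := Finset.card_image_le
          _ = 3 * L ^ 3 := by
              rw [Finset.card_univ, Fintype.card_prod, hV, Fintype.card_fin]
              ring
      calc ((P2.filter (· ∈ edgy)).card : ℝ) ≤ (edgy.card : ℝ) := by exact_mod_cast h3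
        _ ≤ ((3 * L ^ 3 : ℕ) : ℝ) := by exact_mod_cast h4
        _ = 3 * (L : ℝ) ^ 3 := by push_cast; ring
    linarith
  -- `2 C(L³, 2) = L³ (L³ - 1)`
  have hP2 : 2 * (P2.card : ℝ) = (L : ℝ) ^ 3 * ((L : ℝ) ^ 3 - 1) := by
    have h1 : P2.card = (L ^ 3).choose 2 := by
      rw [hP2def, Finset.card_powersetCard, Finset.card_univ, hV]
    have h2 : 2 * (L ^ 3).choose 2 = L ^ 3 * (L ^ 3 - 1) := by
      rw [Nat.choose_two_right]
      exact Nat.two_mul_div_two_of_even (Nat.even_mul_pred_self _)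
    have h3 : 2 * (P2.card : ℝ) = ((2 * (L ^ 3).choose 2 : ℕ) : ℝ) := by
      rw [h1]
      push_cast
      ring
    rw [h3, h2, Nat.cast_mul, Nat.cast_sub (by omega : 1 ≤ L ^ 3)]
    push_cast
    ring
  -- combine
  rw [hnorm, henergy] at hvar
  have h5 : (D₀ + E) * (2 * (P2.card : ℝ)) ≤ 6 * (L : ℝ) ^ 3 := by linarith
  rw [hP2] at h5
  have h6 : ((D₀ + E) * ((L : ℝ) ^ 3 - 1)) * (L : ℝ) ^ 3 ≤ 6 * (L : ℝ) ^ 3 :=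
    calc ((D₀ + E) * ((L : ℝ) ^ 3 - 1)) * (L : ℝ) ^ 3
        = (D₀ + E) * ((L : ℝ) ^ 3 * ((L : ℝ) ^ 3 - 1)) := by ring
      _ ≤ 6 * (L : ℝ) ^ 3 := h5
  exact le_of_mul_le_mul_right h6 hV0

/-- **Registered helper stub `stub_twoBodyBaseEnergy`** (sub-goal of `stub_twoBodyBase`, line
`cosh-budget-penrose-onsager`): for `L ≥ 2` the two-particle sector energy `E(2)` of `xyTorus 3 L 1`
satisfies `(deg(0) + E(2)) (L³ - 1) ≤ 6` (`cb1tb_energy_bound`). [folklore] -/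
theorem stub_twoBodyBaseEnergy :
    ∀ (L : ℕ) [NeZero L], 2 ≤ L →
      ((∑ b : TorusSite 3 L, (if (torusGraph 3 L).Adj 0 b then (1 : ℝ) else 0)) +
          lowestEnergyInSector 1 (xyTorus 3 L 1) (((2 : ℕ) : ℝ) - (L : ℝ) ^ 3 / 2)) *
        ((L : ℝ) ^ 3 - 1) ≤ 6 :=
  fun L _ hL => cb1tb_energy_bound L hL

end Summit.AtomisticToContinuum.BoseEinsteinCondensation.Cruxes.InsertionFieldDelocalisation.CoshBudgetPenroseOnsager

end
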